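import Mathlib.LinearAlgebra.FiniteDimensional.Lemmas
import Mathlib.LinearAlgebra.Matrix.Permanent
import Literature.Computability.AlgebraicComplexity.MignonRessayreBound
import Literature.Computability.AlgebraicComplexity.AlperBogartVelascoSubspace
import Literature.Computability.AlgebraicComplexity.LRPencilOfMatrix
import Literature.Computability.AlgebraicComplexity.OrbitClosureProofs

/-!
# Crux `RefutationDegree.BeyondHessianSos` (stmt-ValiantsHypothesis-5643), line `Sketch` —
# stub `stub_evenTransfer`: the kernel flat of a representation of `per` lies in `Z(per)`

For even `n = p + 3` the semantic half of the crux (infeasibility of `Rep(n, n²/2 + 1)`) is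
reduced by `stub_evenTransfer` to: no linear subspace `W ∋ y₀` of the permanental hypersurface
through the Mignon–Ressayre point `y₀ = mrPoint ℂ p` has `2 · dim W ≥ n²` (stub `stub_noHalfFlat`).
The reduction is the KERNEL FLAT of a representation `per = det A`, `A` affine of size `M`:
after a diagonal symmetry `per ∘ (e × e) = per` a left-kernel vector `κ` of `A(0)` has
`κ A(y₀) ≠ 0` (`EvenTransfer.exists_vecMul_map_eval_ne_zero`); a left-kernel vector `c ≠ 0` of the
singular matrix `N = A(y₀)` is then outside the left kernel of `A(0)` (von zur Gathen /
Alper–Bogart–Velasco regularity: that kernel is the line `K κ`), so writing `c A(v) = c A(0) + β v`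
(`EvenTransfer.vecMul_map_eval`) the flat `K' = ker β` has `dim K' ≥ n² - M` and `y₀ ∉ K'`
(`β y₀ = -c A(0) ≠ 0`).  Moreover `W := K' ⊕ K y₀ ⊆ Z(per)`: `c A(y₀ + u) = c N + β u = 0` for
`u ∈ K'`; homogeneity gives `per(u + t y₀) = tⁿ per(y₀ + t⁻¹ u) = 0` for `t ≠ 0`; and a polynomial
vanishing on the punctured line `u + t y₀` vanishes at `u` (`MvPolynomial.funext_set`).  So
`dim W ≥ n² - M + 1` (`EvenTransfer.exists_flat_of_hasDetRepr_perPoly`), which for `M = n²/2 + 1`,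
`n` even, contradicts `2 dim W < n²`.

The lemmas in namespace `EvenTransfer` are adapted from the lead's support files of this line
(`…KernelFlat.lean`, `…PlusOne.lean`); the sub-namespace keeps the three files jointly importable.
-/

set_option linter.dupNamespace false

noncomputable section

namespace Summit.ValiantsHypothesis.ValiantsHypothesis.Theorems.RefutationDegreeBeyondHessianSos

open Literature.Computability.AlgebraicComplexity MvPolynomial Matrix Module

namespace EvenTransfer

section Affine

variable {K : Type*} [Field K] {σ : Type*} [Fintype σ]

-- adapted from work/KernelFlat.lean (lead, same line)
/-- An affine polynomial is its value at the origin plus its linear part: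
`g(v) = g(0) + Σ_s (coeff_{x_s} g) v_s`. -/
theorem eval_eq_constantCoeff_add_sum (g : MvPolynomial σ K) (hg : g.totalDegree ≤ 1)
    (v : σ → K) :
    eval v g = constantCoeff g + ∑ s, coeff (Finsupp.single s 1) g * v s := by
  classical
  conv_lhs => rw [LRPencil.eq_affine_of_totalDegree_le_one g hg]
  simp [map_add, map_sum, constantCoeff_eq]

-- adapted from work/KernelFlat.lean (lead, same line)
/-- For a matrix `A` of affine entries and a row vector `κ`:
`κ A(v) = κ A(0) + β v`, where `β j s = Σ_l κ_l coeff_{x_s} A_{l j}`. -/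
theorem vecMul_map_eval {ι : Type*} [Fintype ι] (A : Matrix ι ι (MvPolynomial σ K))
    (hA : ∀ i j, (A i j).totalDegree ≤ 1) (κ : ι → K) (v : σ → K) :
    κ ᵥ* A.map (eval v) = κ ᵥ* A.map constantCoeff +
      (Matrix.of fun j s => ∑ l, κ l * coeff (Finsupp.single s 1) (A l j)) *ᵥ v := by
  ext j
  simp only [vecMul, dotProduct, Matrix.map_apply, Pi.add_apply, mulVec, Matrix.of_apply]
  simp_rw [eval_eq_constantCoeff_add_sum _ (hA _ j) v]
  simp only [mul_add, Finset.sum_add_distrib, Finset.mul_sum, Finset.sum_mul]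
  congr 1
  rw [Finset.sum_comm]
  exact Finset.sum_congr rfl fun _ _ => Finset.sum_congr rfl fun _ _ => by ring

end Affine

section Line

variable {K : Type*} [Field K] [Infinite K] {σ : Type*}

/-- If a polynomial vanishes on the punctured line `{u + t y : t ≠ 0}` then it vanishes at `u`
(its restriction to the line is a polynomial in `t` with infinitely many roots). -/
theorem eval_eq_zero_of_forall_ne_zero (f : MvPolynomial σ K) (u y : σ → K)
    (h : ∀ t : K, t ≠ 0 → eval (u + t • y) f = 0) : eval u f = 0 := by
  -- the restriction of `f` to the line, a polynomial in the single variable `X ()`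
  set g : σ → MvPolynomial Unit K := fun s => C (u s) + C (y s) * X () with hg
  have hQ : ∀ x : Unit → K, eval x (bind₁ g f) = eval (u + x () • y) f := by
    intro x
    have h1 : eval x (bind₁ g f) = eval (fun s => eval x (g s)) f :=
      eval₂Hom_bind₁ (RingHom.id K) x g f
    have h2 : (fun s => eval x (g s)) = u + x () • y := by
      funext s
      simp only [hg, map_add, map_mul, eval_C, eval_X, Pi.add_apply, Pi.smul_apply, smul_eq_mul]
      ring
    rw [h1, h2]
  have hQ0 : bind₁ g f = 0 := by
    refine funext_set (fun _ => ({0} : Set K)ᶜ)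
      (fun _ => (Set.finite_singleton (0 : K)).infinite_compl) fun x hx => ?_
    rw [map_zero, hQ]
    exact h _ (Set.mem_compl_singleton_iff.mp (Set.mem_univ_pi.mp hx ()))
  have h0 := hQ fun _ => 0
  simp only [hQ0, map_zero, zero_smul, add_zero] at h0
  exact h0.symm

end Line

section Per

variable {K : Type*} [CommRing K] {m : ℕ}

/-- Homogeneity of the permanent: `per(t x) = t^m per(x)`. -/
theorem eval_smul_perPoly (t : K) (x : Fin m × Fin m → K) :
    eval (t • x) (perPoly (Fin m) K) = t ^ m * eval x (perPoly (Fin m) K) := by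
  rw [eval_perPoly, eval_perPoly]
  have h : (Matrix.of fun i j : Fin m => (t • x) (i, j)) =
      t • Matrix.of fun i j : Fin m => x (i, j) := by
    ext i j; simp only [Matrix.of_apply, Matrix.smul_apply, Pi.smul_apply, smul_eq_mul]
  rw [h, Matrix.permanent_smul, Fintype.card_fin]

end Per

section Point

variable {K : Type*} [Field K]

-- adapted from work/KernelFlat.lean (lead, same line)
/-- A weighted sum of the permuted Mignon–Ressayre points `y₀ ∘ (swap 0 a × swap 0 a)` with
weights summing to zero is the diagonal matrix point `diag(-(p+3) d)`. -/
theorem sum_mul_mrPoint_swap (p : ℕ) (d : Fin (p + 3) → K) (hd : ∑ a, d a = 0)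
    (i j : Fin (p + 3)) :
    (∑ a, d a * mrPoint K p (Equiv.swap 0 a i, Equiv.swap 0 a j)) =
      if i = j then -(((p : K) + 3) * d i) else 0 := by
  have h : ∀ a, mrPoint K p (Equiv.swap 0 a i, Equiv.swap 0 a j) =
      1 + (if i = a ∧ j = a then -((p : K) + 3) else 0) := by
    intro a
    rw [mrPoint_apply]
    simp only [Equiv.swap_apply_eq_iff, Equiv.swap_apply_left]
    split_ifs <;> ring
  simp_rw [h, mul_add, Finset.sum_add_distrib, mul_one, hd, zero_add, mul_ite, mul_zero]
  by_cases hij : i = j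
  · subst hij
    rw [if_pos rfl, Finset.sum_eq_single i]
    · simp only [and_self, if_true]; ring
    · intro a _ ha
      rw [if_neg]
      rintro ⟨rfl, _⟩
      exact ha rfl
    · intro hi; exact absurd (Finset.mem_univ i) hi
  · rw [if_neg hij]
    refine Finset.sum_eq_zero fun a _ => ?_
    rw [if_neg]
    rintro ⟨rfl, rfl⟩
    exact hij rfl

variable [CharZero K]

-- adapted from work/KernelFlat.lean (lead, same line; = neighbour stub `stub_pointChoice`)
/-- **Choice of the point.** For an affine representation `A` of `per_{p+3}` and a non-zero left
kernel vector `κ` of `A(0)`, some permuted Mignon–Ressayre point `y₀ ∘ (swap 0 a × swap 0 a)`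
has `κ A(·) ≠ 0` there: otherwise, by linearity, `κ A(z) = 0` at a weighted sum `z` of these
points which is a diagonal matrix with non-zero diagonal, where `per(z) ≠ 0`. -/
theorem exists_vecMul_map_eval_ne_zero {p M : ℕ}
    (A : Matrix (Fin M) (Fin M) (MvPolynomial (Fin (p + 3) × Fin (p + 3)) K))
    (hA : IsAffineDetRepr (perPoly (Fin (p + 3)) K) A) (κ : Fin M → K) (hκ0 : κ ≠ 0)
    (hκA : κ ᵥ* A.map constantCoeff = 0) :
    ∃ a : Fin (p + 3),
      κ ᵥ* A.map (eval (mrPoint K p ∘ Prod.map (Equiv.swap 0 a) (Equiv.swap 0 a))) ≠ 0 := by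
  classical
  obtain ⟨hdeg, hdet⟩ := hA
  by_contra hall
  push Not at hall
  set β : Matrix (Fin M) (Fin (p + 3) × Fin (p + 3)) K :=
    Matrix.of fun j s => ∑ l, κ l * coeff (Finsupp.single s 1) (A l j) with hβ
  have hβv : ∀ v, κ ᵥ* A.map (eval v) = β *ᵥ v := fun v => by
    rw [vecMul_map_eval A hdeg κ v, hκA, zero_add]
  -- the weights and the test point
  set d : Fin (p + 3) → K := fun a => 1 - if a = 0 then ((p : K) + 3) else 0 with hd
  have hdsum : ∑ a, d a = 0 := by
    simp only [hd, Finset.sum_sub_distrib, Finset.sum_const, Finset.card_univ, Fintype.card_fin,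
      nsmul_eq_mul, mul_one, Finset.sum_ite_eq', Finset.mem_univ, if_true]
    push_cast
    ring
  have hdne : ∀ a, d a ≠ 0 := by
    intro a
    by_cases ha : a = 0
    · have h2 : d a = -((p + 2 : ℕ) : K) := by
        simp only [hd, ha, if_true]
        push_cast
        ring
      rw [h2, neg_ne_zero]
      exact_mod_cast (show (p + 2 : ℕ) ≠ 0 by omega)
    · simp [hd, ha]
  set z : Fin (p + 3) × Fin (p + 3) → K :=
    ∑ a, d a • (mrPoint K p ∘ Prod.map (Equiv.swap 0 a) (Equiv.swap 0 a)) with hz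
  have hz0 : κ ᵥ* A.map (eval z) = 0 := by
    rw [hβv, hz, Matrix.mulVec_sum]
    refine Finset.sum_eq_zero fun a _ => ?_
    rw [Matrix.mulVec_smul, ← hβv, hall a, smul_zero]
  have hdetz : (A.map (eval z)).det = 0 :=
    Matrix.exists_vecMul_eq_zero_iff.mp ⟨κ, hκ0, hz0⟩
  rw [← RingHom.mapMatrix_apply, ← RingHom.map_det, hdet, eval_perPoly] at hdetz
  have hmat : (Matrix.of fun i j : Fin (p + 3) => z (i, j)) =
      Matrix.diagonal fun i => -(((p : K) + 3) * d i) := by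
    ext i j
    rw [Matrix.of_apply, Matrix.diagonal_apply, hz]
    simp only [Finset.sum_apply, Pi.smul_apply, Function.comp_apply, Prod.map_apply, smul_eq_mul]
    exact sum_mul_mrPoint_swap p d hdsum i j
  rw [hmat, Matrix.permanent_diagonal] at hdetz
  refine absurd hdetz (Finset.prod_ne_zero_iff.mpr fun i _ =>
    neg_ne_zero.mpr (mul_ne_zero ?_ (hdne i)))
  exact_mod_cast (show (p + 3 : ℕ) ≠ 0 by omega)

end Point

section Core

variable {K : Type*} [Field K] [CharZero K]

/-- **The kernel flat lies in the permanental hypersurface.** Let `A` be an affine determinantal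
representation of `per_{p+3}` of size `M`, let `κ` be a left-kernel vector of `A(0)` with
`κ A(y₀) ≠ 0` at the Mignon–Ressayre point `y₀`.  Then there is a linear subspace
`W ∋ y₀` of matrix space on which `per` vanishes identically, with `dim W + M ≥ (p+3)² + 1`:
`W = K' ⊕ K y₀` for the kernel flat `K' = {v : c L(v) = 0}` of a left-kernel vector `c` of
`A(y₀)` (`L` the linear part of `A`); `y₀ ∉ K'` by von zur Gathen regularity at the origin,
`y₀ + K' ⊆ Z(per)` because `c A(y₀ + u) = 0`, and the rest of `W` follows by homogeneity and a
one-variable polynomial identity. -/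
theorem exists_flat_of_vecMul_ne_zero {p M : ℕ}
    (A : Matrix (Fin M) (Fin M) (MvPolynomial (Fin (p + 3) × Fin (p + 3)) K))
    (hA : IsAffineDetRepr (perPoly (Fin (p + 3)) K) A) (κ : Fin M → K)
    (hκA : κ ᵥ* A.map constantCoeff = 0) (hκy : κ ᵥ* A.map (eval (mrPoint K p)) ≠ 0) :
    ∃ W : Submodule K (Fin (p + 3) × Fin (p + 3) → K), mrPoint K p ∈ W ∧
      (∀ w ∈ W, eval w (perPoly (Fin (p + 3)) K) = 0) ∧
      (p + 3) ^ 2 + 1 ≤ finrank K W + M := by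
  classical
  obtain ⟨hdeg, hdet⟩ := hA
  set y₀ : Fin (p + 3) × Fin (p + 3) → K := mrPoint K p with hy₀
  -- `det A(v) = per(v)`
  have hdetv : ∀ v, (A.map (eval v)).det = eval v (perPoly (Fin (p + 3)) K) := fun v => by
    rw [← RingHom.mapMatrix_apply, ← RingHom.map_det, hdet]
  -- `N = A(y₀)` is singular: a left-kernel vector `c`
  set N : Matrix (Fin M) (Fin M) K := A.map (eval y₀) with hN
  have hNdet : N.det = 0 := by rw [hN, hdetv, hy₀, eval_mrPoint_perPoly]
  obtain ⟨c, hc0, hcN⟩ := Matrix.exists_vecMul_eq_zero_iff.mpr hNdet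
  -- the constant part `A₀ = A(0)` and regularity: `c A₀ ≠ 0`
  set A₀ : Matrix (Fin M) (Fin M) K := A.map constantCoeff with hA₀
  have hcA₀ : c ᵥ* A₀ ≠ 0 := by
    -- adapted from work/PlusOne.lean (lead, same line)
    intro hc
    have hreg := AlperBogartVelasco.le_rank_map_eval_add_one (K := K) two_ne_zero
      (show 3 ≤ p + 3 by omega) A hdet 0
    rw [MvPolynomial.eval_zero] at hreg
    change M ≤ A₀.rank + 1 at hreg
    have hker : finrank K (LinearMap.ker A₀ᵀ.mulVecLin) ≤ 1 := by
      have h1 := LinearMap.finrank_range_add_finrank_ker A₀ᵀ.mulVecLin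
      rw [finrank_fintype_fun_eq_card, Fintype.card_fin] at h1
      have h2 : finrank K (LinearMap.range A₀ᵀ.mulVecLin) = A₀.rank := by
        rw [← Matrix.rank_transpose]; rfl
      rw [h2] at h1
      omega
    have hmem : ∀ x : Fin M → K, x ᵥ* A₀ = 0 → x ∈ LinearMap.ker A₀ᵀ.mulVecLin := by
      intro x hx
      rw [LinearMap.mem_ker, Matrix.mulVecLin_apply, mulVec_transpose]
      exact hx
    obtain ⟨w, hw⟩ := finrank_le_one_iff.mp hker
    obtain ⟨t₁, ht₁⟩ := hw ⟨κ, hmem κ hκA⟩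
    obtain ⟨t₂, ht₂⟩ := hw ⟨c, hmem c hc⟩
    have e₁ : κ = t₁ • (w : Fin M → K) := by
      simpa using (congr_arg Subtype.val ht₁).symm
    have e₂ : c = t₂ • (w : Fin M → K) := by
      simpa using (congr_arg Subtype.val ht₂).symm
    have ht₂0 : t₂ ≠ 0 := by rintro rfl; rw [zero_smul] at e₂; exact hc0 e₂
    apply hκy
    rw [e₁, smul_vecMul, show (w : Fin M → K) = t₂⁻¹ • c by
      rw [e₂, smul_smul, inv_mul_cancel₀ ht₂0, one_smul], smul_vecMul, hcN, smul_zero, smul_zero]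
  -- affine bookkeeping: `c A(v) = c A₀ + β v`, and `β y₀ = -c A₀`
  set β : Matrix (Fin M) (Fin (p + 3) × Fin (p + 3)) K :=
    Matrix.of fun j s => ∑ l, c l * coeff (Finsupp.single s 1) (A l j) with hβ
  have hβv : ∀ v, c ᵥ* A.map (eval v) = c ᵥ* A₀ + β *ᵥ v := fun v => by
    rw [hβ, hA₀]; exact vecMul_map_eval A hdeg c v
  have hβy₀ : β *ᵥ y₀ = -(c ᵥ* A₀) := by
    have h := hβv y₀
    rw [← hN, hcN] at h
    rw [eq_neg_iff_add_eq_zero, add_comm]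
    exact h.symm
  -- the kernel flat `K' = ker β`, its dimension, `y₀ ∉ K'`
  set K' : Submodule K (Fin (p + 3) × Fin (p + 3) → K) := LinearMap.ker β.mulVecLin with hK'
  have hK'mem : ∀ v, v ∈ K' ↔ β *ᵥ v = 0 := fun v => by
    rw [hK', LinearMap.mem_ker, Matrix.mulVecLin_apply]
  have hK'dim : (p + 3) ^ 2 ≤ finrank K K' + M := by
    have h1 := LinearMap.finrank_range_add_finrank_ker β.mulVecLin
    rw [finrank_fintype_fun_eq_card, Fintype.card_prod, Fintype.card_fin] at h1
    have h2 : finrank K (LinearMap.range β.mulVecLin) ≤ M := by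
      calc finrank K (LinearMap.range β.mulVecLin) ≤ finrank K (Fin M → K) :=
            Submodule.finrank_le _
        _ = M := by rw [finrank_fintype_fun_eq_card, Fintype.card_fin]
    rw [← hK'] at h1
    rw [sq]
    omega
  have hy₀K' : y₀ ∉ K' := by
    intro hy
    have h0 : β *ᵥ y₀ = 0 := (hK'mem y₀).1 hy
    rw [hβy₀, neg_eq_zero] at h0
    exact hcA₀ h0
  have hy₀0 : y₀ ≠ 0 := fun h => by
    have h1 := congrFun h ((0 : Fin (p + 3)), (1 : Fin (p + 3)))
    rw [hy₀, mrPoint_apply] at h1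
    simp at h1
  -- `y₀ + K' ⊆ Z(per)`: `c A(y₀ + u) = c N + β u = 0`
  have hZ1 : ∀ u ∈ K', eval (y₀ + u) (perPoly (Fin (p + 3)) K) = 0 := by
    intro u hu
    rw [← hdetv (y₀ + u)]
    refine Matrix.exists_vecMul_eq_zero_iff.mp ⟨c, hc0, ?_⟩
    rw [hβv, mulVec_add, (hK'mem u).1 hu, add_zero, hβy₀, add_neg_cancel]
  -- homogeneity: `per(u + t y₀) = t^(p+3) per(y₀ + t⁻¹ u) = 0` for `t ≠ 0`
  have hZ2 : ∀ u ∈ K', ∀ t : K, t ≠ 0 → eval (u + t • y₀) (perPoly (Fin (p + 3)) K) = 0 := by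
    intro u hu t ht
    have h := hZ1 _ (K'.smul_mem t⁻¹ hu)
    have heq : u + t • y₀ = t • (y₀ + t⁻¹ • u) := by
      rw [smul_add, smul_smul, mul_inv_cancel₀ ht, one_smul]
      exact add_comm _ _
    rw [heq, eval_smul_perPoly, h, mul_zero]
  -- the punctured line `u + t y₀`, `t ≠ 0`, lies in `Z(per)`, hence so does `u`
  have hZ3 : ∀ u ∈ K', eval u (perPoly (Fin (p + 3)) K) = 0 := fun u hu =>
    eval_eq_zero_of_forall_ne_zero _ u y₀ (hZ2 u hu)
  -- the flat `W = K' ⊕ K y₀`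
  set W : Submodule K (Fin (p + 3) × Fin (p + 3) → K) := K' ⊔ K ∙ y₀ with hW
  have hZW : ∀ w ∈ W, eval w (perPoly (Fin (p + 3)) K) = 0 := by
    intro w hw
    obtain ⟨u, hu, x, hx, rfl⟩ := Submodule.mem_sup.1 hw
    obtain ⟨t, rfl⟩ := Submodule.mem_span_singleton.1 hx
    rcases eq_or_ne t 0 with rfl | ht
    · rw [zero_smul, add_zero]; exact hZ3 u hu
    · exact hZ2 u hu t ht
  have hWdim : finrank K W = finrank K K' + 1 := by
    have hdisj : K' ⊓ (K ∙ y₀) = ⊥ :=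
      disjoint_iff.1 ((Submodule.disjoint_span_singleton' hy₀0).2 hy₀K')
    have hsum := Submodule.finrank_sup_add_finrank_inf_eq K' (K ∙ y₀)
    rw [hdisj, finrank_bot, add_zero, finrank_span_singleton hy₀0] at hsum
    rw [hW, hsum]
  exact ⟨W, Submodule.mem_sup_right (Submodule.mem_span_singleton_self y₀), hZW, by omega⟩

/-- **The kernel flat of a representation of `per_{p+3}`.** An affine determinantal
representation of `per_{p+3}` of size `M` over a field of characteristic zero yields a linear
subspace `W` of matrix space through the Mignon–Ressayre point `y₀`, contained in the permanental
hypersurface, with `dim W ≥ (p+3)² - M + 1` (glue: a left-kernel vector `κ` of `A(0)`, the index `a`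
of `exists_vecMul_map_eval_ne_zero`, and the diagonally conjugated representation
`A ∘ (swap 0 a × swap 0 a)`, again a representation of `per` by `rename_perPoly_equiv`). -/
theorem exists_flat_of_hasDetRepr_perPoly {p M : ℕ} (h : HasDetRepr (perPoly (Fin (p + 3)) K) M) :
    ∃ W : Submodule K (Fin (p + 3) × Fin (p + 3) → K), mrPoint K p ∈ W ∧
      (∀ w ∈ W, eval w (perPoly (Fin (p + 3)) K) = 0) ∧
      (p + 3) ^ 2 + 1 ≤ finrank K W + M := by
  -- adapted from work/PlusOne.lean (lead, same line)
  classical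
  obtain ⟨A, hdeg, hdet⟩ := h
  set A₀ : Matrix (Fin M) (Fin M) K := A.map constantCoeff with hA₀
  have hA₀det : A₀.det = 0 := by
    rw [hA₀, ← RingHom.mapMatrix_apply, ← RingHom.map_det, hdet,
      constantCoeff_perPoly K (show 1 ≤ p + 3 by omega)]
  obtain ⟨κ, hκ0, hκA⟩ := Matrix.exists_vecMul_eq_zero_iff.mpr hA₀det
  obtain ⟨a, ha⟩ := exists_vecMul_map_eval_ne_zero A ⟨hdeg, hdet⟩ κ hκ0 hκA
  set e : Fin (p + 3) ≃ Fin (p + 3) := Equiv.swap 0 a with he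
  set Ae : Matrix (Fin M) (Fin M) (MvPolynomial (Fin (p + 3) × Fin (p + 3)) K) :=
    (rename (Prod.map e e)).mapMatrix A with hAe
  have hAe_aff : IsAffineDetRepr (perPoly (Fin (p + 3)) K) Ae := by
    refine ⟨fun i j => ?_, ?_⟩
    · rw [hAe, AlgHom.mapMatrix_apply, Matrix.map_apply]
      exact (totalDegree_rename_le _ _).trans (hdeg i j)
    · rw [hAe, ← AlgHom.map_det, hdet, rename_perPoly_equiv]
  have hAe0 : Ae.map constantCoeff = A₀ := by ext i j; simp [hAe, hA₀, constantCoeff_rename]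
  have hAey : Ae.map (eval (mrPoint K p)) = A.map (eval (mrPoint K p ∘ Prod.map e e)) := by
    ext i j; simp [hAe, eval_rename]
  refine exists_flat_of_vecMul_ne_zero Ae hAe_aff κ (by rw [hAe0]; exact hκA) ?_
  rw [hAey, he]
  exact ha

end Core

end EvenTransfer

/-- **Stub `stub_evenTransfer` of the lead skeleton (line `Sketch`, crux
`RefutationDegree.BeyondHessianSos`), even `n = p + 3`, the transfer.** If no linear subspace `W`
of matrix space containing the Mignon–Ressayre point `y₀ = mrPoint ℂ p` and contained in the
permanental hypersurface has `2 · dim W ≥ (p+3)²`, then `per_{p+3}` has no affine determinantal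
representation of size `(p+3)²/2 + 1`: the kernel flat `K' ⊕ ℂ y₀` of such a representation
(`EvenTransfer.exists_flat_of_hasDetRepr_perPoly`) lies in `Z(per)`, contains `y₀` and has
dimension `≥ (p+3)² - ((p+3)²/2 + 1) + 1 = (p+3)²/2` for even `p + 3`. -/
theorem stub_evenTransfer (p : ℕ) (heven : (p + 3) % 2 = 0)
    (hW : ∀ W : Submodule ℂ (Fin (p + 3) × Fin (p + 3) → ℂ), mrPoint ℂ p ∈ W →
      (∀ w ∈ W, MvPolynomial.eval w (perPoly (Fin (p + 3)) ℂ) = 0) →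
      2 * Module.finrank ℂ W < (p + 3) ^ 2) :
    ¬ HasDetRepr (perPoly (Fin (p + 3)) ℂ) ((p + 3) ^ 2 / 2 + 1) := by
  intro h
  obtain ⟨W, hy, hZ, hdim⟩ := EvenTransfer.exists_flat_of_hasDetRepr_perPoly h
  have hlt := hW W hy hZ
  have hpar : (p + 3) ^ 2 % 2 = (p + 3) % 2 := by
    rw [sq, Nat.mul_mod]
    rcases Nat.mod_two_eq_zero_or_one (p + 3) with h0 | h0 <;> simp [h0]
  omega

end Summit.ValiantsHypothesis.ValiantsHypothesis.Theorems.RefutationDegreeBeyondHessianSos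

end
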